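import Summits.QuantumFields.YangMills.Theorems.UnitScaleTiltProp7Lane2PartitionOfUnity
import HarnessLib

/-!
# Route `UnitScaleTilt`, crux «MinimiserStabilityRegPr» (stmt-QuantumFields-19200), E′ ∕ (N06) LANE II «DIVERGENCE RECOVERY AT CURVED `W`» — brick (B6-a), export (Z0):
# ★★ THE PARTITION OF UNITY AT SCALE `R = L^s` WITH ITS CENTRE SET DISPLAYED — `Z = {κ ↦ g_κ·(L^s·L^{K−n}) : g ∈ [0, 2L^{m+n−s})³}`, THE CORNERS OF THE COARSE GRID

Cell `ym3-torus`, width seat `ym3-torus-px4` (gen 9, «width 4»); lineage (B6) = `ym3-torus-px11` g6 (✓`Prop7Lane2PartitionOfUnity.exists_partitionOfUnity`, whose construction this file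
re-runs with the centre set moved from the `∃` into the STATEMENT — the (Z0) export asked by `ym3-torus-px9` g7, 2026-08-29 08:48Z, for the [I-9] member knit of ★p1).
THEOREMS ONLY (0 `def`, 0 `sorry`); `--supports stmt-QuantumFields-19200`, count-neutral.  YM₃ on T³ is a ladder rung (R3), NOT d = 4, NOT infinite volume, NOT a mass gap, NOT the
Clay problem; nothing here claims (B6), (B7), the divergence-recovery row (REC), `hN06`, E′, EX, the crux or the gap.

WHY.  The frozen patch schema `hPatch` of ✓`Prop7DivRecoveryPatchesToRows.hRows_of_core_and_patches` indexes the cutoff families by ALL fine sites `i : Site (F.P K) 0` and displays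
the three resource rows `Σ_i N_i ≤ ν‖y‖²`, `Σ_i Cu_i ≤ ν·CURL`, `Σ_i As_i ≤ ν·AVG`; the knit's resources are per-centre chart-box sums supported on the centre set, and the only
multiplicity count in the tree is ✓`Prop7Lane2PatchGeometry.sum_grid_sum_patch_le` — a sum over the grid `g`.  The two meet through `Finset.sum_image` once the centre set IS the
injective image of the grid; ✓`exists_partitionOfUnity` hides that set behind `∃ Z` (its rows alone allow idle centres with `ζ_c ≡ 0`, so they imply no box multiplicity).  This file
displays it.

WHAT IS PROVED (ns `…Theorems.Prop7Lane2PartitionOfUnityGrid`):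
* ★ `corner_injOn` — the corner map `g ↦ (κ ↦ ↑(g_κ·(L^s·L^{K−n})))` is injective on the grid `[0, 2L^{m+n−s})³` (`n ≤ K`, `s ≤ m + n`);
* ★★ `exists_partitionOfUnity_grid` — the seven rows of ✓`exists_partitionOfUnity` VERBATIM (values in `[0,1]`, `Σ_{c∈Z} ζ c x = 1`, `ζ c = 0` off `Z`, support `< L^s·L^{K−n}`,
  `#alive ≤ 8`, steps `≤ (3∕2)∕(L^s·L^{K−n})`, second differences `≤ 6∕(L^s·L^{K−n})²`) with `Z := (grid).image corner` written out; proof = px11 g6's construction re-run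
  (products of the cyclic smoothstep hats of ✓`Prop7Lane2CyclicHats` at spacing `M = L^s·L^{K−n}` on `ZMod (A·M)`, `A = 2L^{m+n−s}`).
HONEST SCOPE.  Finite bookkeeping over px11's hats; nothing of the lattice gauge theory or of print is asserted; rung R3, not Clay; YM gap NOT proved.

References: T. Bałaban, CMP 99 (1985) 389–434 [Balaban1985BackgroundPropagators] ((3.100) pp.413–414: the partition of unity `h` at scale `M`, its centres on `Mℤᵈ`, finite overlap);
[folklore] (injectivity of `a ↦ a·M mod A·M` on `a < A`).
-/

set_option autoImplicit false

noncomputable section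

open scoped BigOperators

namespace Summit.QuantumFields.YangMills.Theorems.Prop7Lane2PartitionOfUnityGrid

open Literature.MathematicalPhysics.QuantumFieldTheory.Balaban1983to89
open Literature.MathematicalPhysics.QuantumFieldTheory.Balaban1983to89.T3ContinuumYM3Torus
open Summit.QuantumFields.YangMills.Theorems.Prop7Lane2CyclicHats
open Summit.QuantumFields.YangMills.Theorems.Prop7Lane2PartitionOfUnity (sitesPerDir_eq_mul two_le_A one_le_M)
open Finset

variable (F : T3Family) (n K s : ℕ)

/-- ★ **THE CORNER MAP IS INJECTIVE ON THE GRID**: `g ↦ (κ ↦ ↑(g_κ·(L^s·L^{K−n})))` is one-to-one on `[0, 2L^{m+n−s})³` — the labels `g_κ·M < A·M = 2L^{m+K}` do not wrap.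
[folklore] -/
theorem corner_injOn (hnK : n ≤ K) (hs : s ≤ F.m + n) :
    Set.InjOn ((fun g κ => ((g κ * (F.L ^ s * F.L ^ (K - n)) : ℕ) : ZMod ((F.P K).sitesPerDir 0))) : (Fin 3 → ℕ) → Site (F.P K) 0)
      ↑(Fintype.piFinset fun _ : Fin 3 => Finset.range (2 * F.L ^ (F.m + n - s))) := by
  have hM : 1 ≤ F.L ^ s * F.L ^ (K - n) := one_le_M F n K s
  have hN : (F.P K).sitesPerDir 0 = (2 * F.L ^ (F.m + n - s)) * (F.L ^ s * F.L ^ (K - n)) := sitesPerDir_eq_mul F n K s hnK hs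
  intro g hg g' hg' h
  rw [Finset.mem_coe, Fintype.mem_piFinset] at hg hg'
  funext κ
  have hκ := congrFun h κ
  have hAκ := Finset.mem_range.mp (hg κ)
  have hAκ' := Finset.mem_range.mp (hg' κ)
  have hlt : g κ * (F.L ^ s * F.L ^ (K - n)) < (F.P K).sitesPerDir 0 := by rw [hN]; exact Nat.mul_lt_mul_of_pos_right hAκ (by omega)
  have hlt' : g' κ * (F.L ^ s * F.L ^ (K - n)) < (F.P K).sitesPerDir 0 := by rw [hN]; exact Nat.mul_lt_mul_of_pos_right hAκ' (by omega)
  have hv := congrArg ZMod.val hκ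
  simp only [ZMod.val_cast_of_lt hlt, ZMod.val_cast_of_lt hlt'] at hv
  exact Nat.eq_of_mul_eq_mul_right (by omega) hv

/-- ★★ **(Z0) THE PARTITION OF UNITY AT SCALE `R = L^s` WITH ITS CENTRES DISPLAYED**: for `n < K` and `s < m + n`, with the centre set
`Z := {κ ↦ ↑(g_κ·(L^s·L^{K−n})) : g ∈ [0, 2L^{m+n−s})³}` (the corners of the coarse grid `κ ↦ g_κ·L^s`), there are cutoffs `ζ` on the fine torus `Site (F.P K) 0` with the seven rows of
✓`exists_partitionOfUnity` verbatim: values in `[0,1]`; `Σ_{c∈Z} ζ c x = 1`; `ζ c = 0` off `Z`; `ζ c x ≠ 0 →` each coordinate of `x` within cyclic distance `< L^s·L^{K−n}` of `c`'s; at most `8`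
alive at any `x`; steps `≤ (3∕2)∕(L^s·L^{K−n})`; second differences `≤ 6∕(L^s·L^{K−n})²`. [cite: Balaban1985BackgroundPropagators, (3.100) p.413] -/
theorem exists_partitionOfUnity_grid (hnK : n < K) (hs : s < F.m + n) :
    ∃ (ζ : Site (F.P K) 0 → Site (F.P K) 0 → ℝ),
      (∀ c x, 0 ≤ ζ c x ∧ ζ c x ≤ 1) ∧
      (∀ x, ∑ c ∈ ((Fintype.piFinset fun _ : Fin 3 => Finset.range (2 * F.L ^ (F.m + n - s))).image
        (fun g κ => ((g κ * (F.L ^ s * F.L ^ (K - n)) : ℕ) : ZMod ((F.P K).sitesPerDir 0))) : Finset (Site (F.P K) 0)), ζ c x = 1) ∧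
      (∀ c, c ∉ ((Fintype.piFinset fun _ : Fin 3 => Finset.range (2 * F.L ^ (F.m + n - s))).image
        (fun g κ => ((g κ * (F.L ^ s * F.L ^ (K - n)) : ℕ) : ZMod ((F.P K).sitesPerDir 0))) : Finset (Site (F.P K) 0)) → ∀ x, ζ c x = 0) ∧
      (∀ c x, ζ c x ≠ 0 → ∀ κ : Fin 3, min (x κ - c κ).val (c κ - x κ).val < F.L ^ s * F.L ^ (K - n)) ∧
      (∀ x, ((((Fintype.piFinset fun _ : Fin 3 => Finset.range (2 * F.L ^ (F.m + n - s))).image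
        (fun g κ => ((g κ * (F.L ^ s * F.L ^ (K - n)) : ℕ) : ZMod ((F.P K).sitesPerDir 0))) : Finset (Site (F.P K) 0))).filter (fun c => ζ c x ≠ 0)).card ≤ 8) ∧
      (∀ c x (μ : Fin 3), |ζ c (x.shift μ) - ζ c x| ≤ 3 / 2 / ((F.L : ℝ) ^ s * (F.L : ℝ) ^ (K - n)) ∧
        |ζ c (x.unshift μ) - ζ c x| ≤ 3 / 2 / ((F.L : ℝ) ^ s * (F.L : ℝ) ^ (K - n))) ∧
      (∀ c x (μ : Fin 3), |ζ c (x.shift μ) + ζ c (x.unshift μ) - 2 * ζ c x| ≤ 6 / ((F.L : ℝ) ^ s * (F.L : ℝ) ^ (K - n)) ^ 2) := by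
  classical
  -- name the displayed centre set, and record its injectivity, BEFORE the letters are abbreviated
  generalize hZ : ((Fintype.piFinset fun _ : Fin 3 => Finset.range (2 * F.L ^ (F.m + n - s))).image
        (fun g κ => ((g κ * (F.L ^ s * F.L ^ (K - n)) : ℕ) : ZMod ((F.P K).sitesPerDir 0))) : Finset (Site (F.P K) 0)) = Z
  have hinj := corner_injOn F n K s hnK.le hs.le
  -- letters
  set M : ℕ := F.L ^ s * F.L ^ (K - n) with hMdef
  set A : ℕ := 2 * F.L ^ (F.m + n - s) with hAdef
  have hM : 1 ≤ M := one_le_M F n K s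
  have hA : 2 ≤ A := two_le_A F n s
  have hN : (F.P K).sitesPerDir 0 = A * M := sitesPerDir_eq_mul F n K s hnK.le hs.le
  have hMR : (M : ℝ) = (F.L : ℝ) ^ s * (F.L : ℝ) ^ (K - n) := by rw [hMdef]; push_cast; ring
  -- the one-dimensional hat at distance `d`
  let H : ℕ → ℝ := fun d => 1 - 3 * (max 0 (min ((d : ℝ) / M) 1)) ^ 2 + 2 * (max 0 (min ((d : ℝ) / M) 1)) ^ 3
  -- the centres and the cutoffs
  let emb : (Fin 3 → ℕ) → Site (F.P K) 0 := fun g κ => (((g κ * M : ℕ)) : ZMod ((F.P K).sitesPerDir 0))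
  let ζ : Site (F.P K) 0 → Site (F.P K) 0 → ℝ := fun c x =>
    if c ∈ Z then ∏ κ : Fin 3, H (min (x κ - c κ).val (c κ - x κ).val) else 0
  have hH01 : ∀ d, 0 ≤ H d ∧ H d ≤ 1 := fun d => hat_mem d
  have hprod01 : ∀ c x : Site (F.P K) 0, 0 ≤ ∏ κ : Fin 3, H (min (x κ - c κ).val (c κ - x κ).val) ∧ ∏ κ : Fin 3, H (min (x κ - c κ).val (c κ - x κ).val) ≤ 1 :=
    fun c x => ⟨Finset.prod_nonneg fun κ _ => (hH01 _).1, Finset.prod_le_one (fun κ _ => (hH01 _).1) fun κ _ => (hH01 _).2⟩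
  refine ⟨ζ, ?_, ?_, ?_, ?_, ?_, ?_, ?_⟩
  -- values in `[0,1]`
  · intro c x
    simp only [ζ]
    split_ifs
    · exact hprod01 c x
    · exact ⟨le_rfl, zero_le_one⟩
  -- sum to one
  · intro x
    have hZ1 : ∀ c ∈ Z, ζ c x = ∏ κ : Fin 3, H (min (x κ - c κ).val (c κ - x κ).val) := fun c hc => by simp only [ζ, if_pos hc]
    rw [Finset.sum_congr rfl hZ1, ← hZ]
    refine (Finset.sum_image hinj).trans ?_
    show ∑ g ∈ Fintype.piFinset (fun _ : Fin 3 => Finset.range A), ∏ κ : Fin 3,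
        H (min (x κ - (((g κ * M : ℕ)) : ZMod ((F.P K).sitesPerDir 0))).val ((((g κ * M : ℕ)) : ZMod ((F.P K).sitesPerDir 0)) - x κ).val) = 1
    have hps := Finset.sum_prod_piFinset (Finset.range A)
      (fun (κ : Fin 3) (a : ℕ) => H (min (x κ - ((a * M : ℕ) : ZMod ((F.P K).sitesPerDir 0))).val ((((a * M : ℕ) : ZMod ((F.P K).sitesPerDir 0))) - x κ).val))
    rw [hps]
    exact Finset.prod_eq_one fun κ _ => sum_hats_eq_one hN hA hM (x κ)
  -- zero off `Z`
  · intro c hc x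
    simp only [ζ, if_neg hc]
  -- support
  · intro c x hne κ
    simp only [ζ] at hne
    split_ifs at hne with hc
    · exact lt_of_hat_ne_zero hM (Finset.prod_ne_zero_iff.mp hne κ (Finset.mem_univ κ))
    · exact absurd rfl hne
  -- at most eight alive
  · intro x
    have hsub : Z.filter (fun c => ζ c x ≠ 0) ⊆ (Fintype.piFinset fun κ : Fin 3 => (Finset.range A).filter
        (fun a => H (min (x κ - ((a * M : ℕ) : ZMod ((F.P K).sitesPerDir 0))).val ((((a * M : ℕ) : ZMod ((F.P K).sitesPerDir 0))) - x κ).val) ≠ 0)).image emb := by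
      intro c hc
      rw [Finset.mem_filter] at hc
      obtain ⟨hcZ, hne⟩ := hc
      simp only [ζ, if_pos hcZ] at hne
      rw [← hZ] at hcZ
      obtain ⟨g, hg, rfl⟩ := Finset.mem_image.mp hcZ
      refine Finset.mem_image.mpr ⟨g, ?_, rfl⟩
      rw [Fintype.mem_piFinset] at hg ⊢
      intro κ
      exact Finset.mem_filter.mpr ⟨hg κ, Finset.prod_ne_zero_iff.mp hne κ (Finset.mem_univ κ)⟩
    refine (Finset.card_le_card hsub).trans (Finset.card_image_le.trans ?_)
    rw [Fintype.card_piFinset]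
    calc ∏ κ : Fin 3, ((Finset.range A).filter (fun a => H (min (x κ - ((a * M : ℕ) : ZMod ((F.P K).sitesPerDir 0))).val
            ((((a * M : ℕ) : ZMod ((F.P K).sitesPerDir 0))) - x κ).val) ≠ 0)).card
        ≤ ∏ _κ : Fin 3, 2 := Finset.prod_le_prod' fun κ _ => card_hats_ne_zero_le_two hN hA hM (x κ)
      _ = 8 := by norm_num
  -- steps
  · intro c x μ
    by_cases hc : c ∈ Z
    · simp only [ζ, if_pos hc]
      have hsplit : ∀ y : Site (F.P K) 0, ∏ κ : Fin 3, H (min (y κ - c κ).val (c κ - y κ).val)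
          = (∏ κ ∈ Finset.univ.erase μ, H (min (y κ - c κ).val (c κ - y κ).val)) * H (min (y μ - c μ).val (c μ - y μ).val) :=
        fun y => (Finset.prod_erase_mul _ _ (Finset.mem_univ μ)).symm
      have hrest : ∀ y : Site (F.P K) 0, (∀ κ, κ ≠ μ → y κ = x κ) →
          ∏ κ ∈ Finset.univ.erase μ, H (min (y κ - c κ).val (c κ - y κ).val) = ∏ κ ∈ Finset.univ.erase μ, H (min (x κ - c κ).val (c κ - x κ).val) :=
        fun y hy => Finset.prod_congr rfl fun κ hκ => by rw [hy κ (Finset.ne_of_mem_erase hκ)]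
      have hP0 : 0 ≤ ∏ κ ∈ Finset.univ.erase μ, H (min (x κ - c κ).val (c κ - x κ).val) := Finset.prod_nonneg fun κ _ => (hH01 _).1
      have hP1 : ∏ κ ∈ Finset.univ.erase μ, H (min (x κ - c κ).val (c κ - x κ).val) ≤ 1 :=
        Finset.prod_le_one (fun κ _ => (hH01 _).1) fun κ _ => (hH01 _).2
      have hsh : ∀ κ, κ ≠ μ → (x.shift μ) κ = x κ := fun κ hκ => Function.update_of_ne hκ _ _
      have hush : ∀ κ, κ ≠ μ → (x.unshift μ) κ = x κ := fun κ hκ => Function.update_of_ne hκ _ _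
      have hshμ : (x.shift μ) μ = x μ + 1 := Function.update_self _ _ _
      have hushμ : (x.unshift μ) μ = x μ - 1 := Function.update_self _ _ _
      obtain ⟨hstepP, hstepM⟩ := abs_hat_step_le hN hA hM (c μ) (x μ)
      rw [hsplit (x.shift μ), hsplit (x.unshift μ), hsplit x, hrest _ hsh, hrest _ hush, hshμ, hushμ, ← mul_sub, ← mul_sub, abs_mul, abs_mul,
        abs_of_nonneg hP0, ← hMR]
      constructor
      · calc _ ≤ 1 * (3 / 2 / (M : ℝ)) := mul_le_mul hP1 hstepP (abs_nonneg _) zero_le_one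
          _ = _ := one_mul _
      · calc _ ≤ 1 * (3 / 2 / (M : ℝ)) := mul_le_mul hP1 hstepM (abs_nonneg _) zero_le_one
          _ = _ := one_mul _
    · simp only [ζ, if_neg hc, sub_zero, abs_zero]
      constructor <;> positivity
  -- second differences
  · intro c x μ
    by_cases hc : c ∈ Z
    · simp only [ζ, if_pos hc]
      have hsplit : ∀ y : Site (F.P K) 0, ∏ κ : Fin 3, H (min (y κ - c κ).val (c κ - y κ).val)
          = (∏ κ ∈ Finset.univ.erase μ, H (min (y κ - c κ).val (c κ - y κ).val)) * H (min (y μ - c μ).val (c μ - y μ).val) :=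
        fun y => (Finset.prod_erase_mul _ _ (Finset.mem_univ μ)).symm
      have hrest : ∀ y : Site (F.P K) 0, (∀ κ, κ ≠ μ → y κ = x κ) →
          ∏ κ ∈ Finset.univ.erase μ, H (min (y κ - c κ).val (c κ - y κ).val) = ∏ κ ∈ Finset.univ.erase μ, H (min (x κ - c κ).val (c κ - x κ).val) :=
        fun y hy => Finset.prod_congr rfl fun κ hκ => by rw [hy κ (Finset.ne_of_mem_erase hκ)]
      have hP0 : 0 ≤ ∏ κ ∈ Finset.univ.erase μ, H (min (x κ - c κ).val (c κ - x κ).val) := Finset.prod_nonneg fun κ _ => (hH01 _).1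
      have hP1 : ∏ κ ∈ Finset.univ.erase μ, H (min (x κ - c κ).val (c κ - x κ).val) ≤ 1 :=
        Finset.prod_le_one (fun κ _ => (hH01 _).1) fun κ _ => (hH01 _).2
      have hsh : ∀ κ, κ ≠ μ → (x.shift μ) κ = x κ := fun κ hκ => Function.update_of_ne hκ _ _
      have hush : ∀ κ, κ ≠ μ → (x.unshift μ) κ = x κ := fun κ hκ => Function.update_of_ne hκ _ _
      have hshμ : (x.shift μ) μ = x μ + 1 := Function.update_self _ _ _
      have hushμ : (x.unshift μ) μ = x μ - 1 := Function.update_self _ _ _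
      have hsec := abs_hat_second_le hN hA hM (c μ) (x μ)
      rw [hsplit (x.shift μ), hsplit (x.unshift μ), hsplit x, hrest _ hsh, hrest _ hush, hshμ, hushμ]
      set P := ∏ κ ∈ Finset.univ.erase μ, H (min (x κ - c κ).val (c κ - x κ).val)
      rw [show P * H (min (x μ + 1 - c μ).val (c μ - (x μ + 1)).val) + P * H (min (x μ - 1 - c μ).val (c μ - (x μ - 1)).val)
          - 2 * (P * H (min (x μ - c μ).val (c μ - x μ).val))
          = P * (H (min (x μ + 1 - c μ).val (c μ - (x μ + 1)).val) + H (min (x μ - 1 - c μ).val (c μ - (x μ - 1)).val)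
              - 2 * H (min (x μ - c μ).val (c μ - x μ).val)) by ring, abs_mul, abs_of_nonneg hP0, ← hMR]
      calc _ ≤ 1 * (6 / (M : ℝ) ^ 2) := mul_le_mul hP1 hsec (abs_nonneg _) zero_le_one
        _ = _ := one_mul _
    · simp only [ζ, if_neg hc, mul_zero, add_zero, sub_zero, abs_zero]
      positivity


end Summit.QuantumFields.YangMills.Theorems.Prop7Lane2PartitionOfUnityGrid

end
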